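import Mathlib.Topology.Homotopy.HomotopyGroup
import Mathlib.AlgebraicTopology.FundamentalGroupoid.FundamentalGroup
import Mathlib.Algebra.Group.TypeTags.Finite
import Mathlib.RepresentationTheory.Homological.GroupCohomology.Functoriality
import Literature.Topology.FourManifolds.SmoothOrientation
import HarnessLib

/-!
# `H³(π̂₁(N); ℤ/2) ≠ 0` for a closed orientable aspherical 3-manifold — the named fact, finite level

Topic `Literature/Topology/FourManifolds`. This module holds ONE named fact (D-0014), no proofs:
`profinite_H3_ne_zero_of_aspherical`, the single deep input of the accepted reduction
`Literature.Topology.FourManifolds.not_lift_fundamentalGroup_of_aspherical_of_profinite_H3`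
(`AsphericalThreeManifoldGroupNotProjectiveProofs.lean`), whose hypothesis binder `h` it restates
VERBATIM (librarian sweep g24, vend-from-binder, promote event 3316553; first consumer = that
reduction, whence `not_lift_fundamentalGroup_of_aspherical` follows by one application).

## Source and reading

Aschenbrenner–Friedl–Wilton, *3-Manifold Groups* (EMS 2015; arXiv:1205.0202v3 numbering), proof
of Prop. 9.29, for a closed aspherical 3-manifold `N₁`: "Because `π₁(N₁)` is residually finite
and good, we have `H³(π̂₁(N₁); ℤ/2) ≅ H³(π₁(N₁); ℤ/2)` … But `H³(π₁(N₁); ℤ/2) ≅ H³(N₁; ℤ/2) ≅ ℤ/2`",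
with §6 (G.24) for goodness of 3-manifold groups (Wilton–Zalesskii for graph manifolds; (H.5),
(G.2), (G.3), (G.5), (G.17), (G.20) otherwise; Cavendish after Wise in general). The profinite
cohomology is the direct limit over the finite quotients, Serre, *Cohomologie galoisienne*, I §2.2
Prop. 8 Cor. 1: `Hⁿ(Ĝ; A) = lim_→ Hⁿ(G/U; A)` over the open normal subgroups `U`. Hence the
non-vanishing of `H³(π̂₁; ℤ/2)` reads, at the FINITE level and without forming the profinite
completion: some class `x ∈ H³(Q; ℤ/2)` over a finite quotient `π : π₁(N) ↠ Q` has non-zero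
inflation `φ^* x` to every finite quotient `π' : π₁(N) ↠ Q'` factoring `π = φ ∘ π'`. That is the
statement below (with `H³(Q; ℤ/2) = groupCohomology (Rep.trivial (ZMod 2) Q (ZMod 2)) 3` and
`φ^* = groupCohomology.map φ (𝟙 _) 3`), over the tree's smooth-manifold vocabulary: `Z` a compact
connected orientable (`IsOrientable (𝓡 3) Z`, `SmoothOrientation.lean`) boundaryless smooth
3-manifold, aspherical in the sense `π_n(Z, z)` trivial for all `n ≥ 2`.

What is deliberately NOT here: goodness as a notion, profinite completions, the fundamental class
`H³(N; ℤ/2) ≅ ℤ/2` — the fact packages all three steps of the printed argument; discharging it is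
theory-sized (Geometrisation/Agol–Wise enter through goodness).
-/

noncomputable section

open scoped Manifold ContDiff
open CategoryTheory

namespace Literature.Topology.FourManifolds

universe u

/-- **`H³(π̂₁(Z); ℤ/2) ≠ 0` for a closed connected orientable aspherical smooth 3-manifold `Z`**,
finite-level form (Serre I §2.2 Cor. 1: `H³(Ĝ; ℤ/2) = lim_→ H³(Q; ℤ/2)` over the finite quotients
`G ↠ Q`): there are a finite group `Q`, a surjection `π : π₁(Z, z) ↠ Q` and a class
`x ∈ H³(Q; ℤ/2)` (group cohomology of the trivial module `ZMod 2`) whose pull-back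
`groupCohomology.map φ (𝟙 _) 3 x` is non-zero for every finite quotient `π' : π₁(Z, z) ↠ Q'` and
every `φ : Q' →* Q` with `φ ∘ π' = π`. Printed proof: `π₁(Z)` is good (AFW §6 (G.24)), so
`H³(π̂₁(Z); ℤ/2) ≅ H³(π₁(Z); ℤ/2) ≅ H³(Z; ℤ/2) ≅ ℤ/2` (`Z` is a `K(π₁, 1)` and a closed orientable
3-manifold; AFW proof of Prop. 9.29). VERBATIM the hypothesis `h` of
`not_lift_fundamentalGroup_of_aspherical_of_profinite_H3` (same universe `u`); users take
`(h : profinite_H3_ne_zero_of_aspherical)`. Named fact (D-0014), not proved in the tree.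
[cite: AschenbrennerFriedlWilton2015, §9.13 Prop. 9.29 (proof) with §6 (G.24); arXiv:1205.0202v3 numbering]
[cite: Serre1997, I §2.2 Prop. 8 Cor. 1; I §2.6 Ex. 2 (good groups)] -/
def profinite_H3_ne_zero_of_aspherical : Prop :=
  ∀ (Z : Type u) [TopologicalSpace Z] [T2Space Z] [SecondCountableTopology Z]
    [ChartedSpace (EuclideanSpace ℝ (Fin 3)) Z] [IsManifold (𝓡 3) ∞ Z] [CompactSpace Z]
    [ConnectedSpace Z] (_ : IsOrientable (𝓡 3) Z) (z : Z),
    (∀ n : ℕ, 2 ≤ n → Subsingleton (HomotopyGroup (Fin n) Z z)) →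
    ∃ (Q : Type) (_ : Group Q) (_ : Finite Q) (π : FundamentalGroup Z z →* Q)
      (x : groupCohomology (Rep.trivial (ZMod 2) Q (ZMod 2)) 3),
      Function.Surjective π ∧
      ∀ (Q' : Type) [Group Q'] [Finite Q'] (π' : FundamentalGroup Z z →* Q') (φ : Q' →* Q),
        Function.Surjective π' → φ.comp π' = π →
        groupCohomology.map φ (𝟙 (Rep.res φ (Rep.trivial (ZMod 2) Q (ZMod 2)))) 3 x ≠ 0

end Literature.Topology.FourManifolds

end
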